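import Mathlib.RingTheory.AdjoinRoot
import Mathlib.Algebra.Polynomial.Expand
import Mathlib.RingTheory.TensorProduct.Basic
import Mathlib.RingTheory.PolynomialAlgebra
import Mathlib.Algebra.CharP.Lemmas
import Mathlib.RingTheory.Flat.Basic
import HarnessLib

/-!
# The Frobenius pull-back `A[x] ⊆ A[y]`, `x = y^q`

Topic: `Literature/AlgebraicGeometry/Resolution`. Elementary algebra for the case `𝔯 = 0` in
characteristic `p` of Grothendieck's theorem "`R` a G-ring ⇒ `R[x]` a G-ring" (The Stacks
Project, Tag 07PV): the ring `T' = A[x][y]/(y^q - x)` as a finite free `A[x]`-algebra isomorphic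
to the polynomial ring `A[y]` over `A`, and the `q`-th roots `g(y^q) = (Σ c_j^{1/q} y^j)^q` of the
images of polynomials `g = Σ c_j x^j` in `T' ⊗_A L` once `L ∋ c_j^{1/q}` (`q` a power of the
characteristic). Everything is PROVED; the only definitions are the ring `FrobTwist A q` (an
`AdjoinRoot`) and its two structure maps to and from `A[X]`; no named facts.

## Content (namespace `Literature.AlgebraicGeometry.Resolution`)

* `frobTwistPoly A q = y^q - x ∈ A[x][y]`, `FrobTwist A q = A[x][y]/(y^q - x)`.
* `FrobTwist.monic`, `FrobTwist.instModuleFinite`, `FrobTwist.instModuleFree` — finite free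
  over `A[x]`; `FrobTwist.of_X` — `x = y^q`.
* `FrobTwist.toPolynomial`, `FrobTwist.ofPolynomial`, `FrobTwist.exists_algEquiv_polynomial` —
  `FrobTwist A q ≃ₐ[A] A[X]` (`y ↦ X`, `x ↦ X^q`); `FrobTwist.algebraMap_injective`.
* `FrobTwist.exists_pow_eq_algebraMap` — `g ⊗ 1` is the `q`-th power of `Σ_j y^j ⊗ c_j^{1/q}`
  in `FrobTwist A q ⊗_A L`, given `q`-th roots of the coefficients of `g` in `L`.

## Sources

* The Stacks Project, Tag 07PV (proof: reduction to `𝔯 = 0`), Tag 07PR. [StacksProject]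
-/

noncomputable section

open Polynomial TensorProduct

namespace Literature.AlgebraicGeometry.Resolution

universe u

variable (A : Type u) [CommRing A] (q : ℕ)

/-- The polynomial `y^q - x ∈ A[x][y]`. [folklore] -/
abbrev frobTwistPoly : (A[X])[X] := X ^ q - C (X : A[X])

/-- `A[x][y]/(y^q - x)`, the Frobenius pull-back of `A[x]` (for `q` a power of the
characteristic): an `A[x]`-algebra, and an `A`-algebra isomorphic to `A[y]`. [folklore] -/
abbrev FrobTwist : Type u := AdjoinRoot (frobTwistPoly A q)

namespace FrobTwist

variable {A q}

/-- `y^q - x` is monic for `q ≠ 0`. [folklore] -/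
theorem monic (hq : q ≠ 0) : (frobTwistPoly A q).Monic :=
  Polynomial.monic_X_pow_sub_C _ hq

/-- `A[x][y]/(y^q - x)` is finite over `A[x]`. [folklore] -/
theorem moduleFinite (hq : q ≠ 0) : Module.Finite A[X] (FrobTwist A q) :=
  (monic hq).finite_adjoinRoot

/-- `A[x][y]/(y^q - x)` is free over `A[x]`. [folklore] -/
theorem moduleFree (hq : q ≠ 0) : Module.Free A[X] (FrobTwist A q) :=
  (monic hq).free_adjoinRoot

variable (A q)

/-- In `A[x][y]/(y^q - x)`: the image of `x` is `y^q`. [folklore] -/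
theorem of_X : algebraMap A[X] (FrobTwist A q) X = AdjoinRoot.root (frobTwistPoly A q) ^ q := by
  have h := AdjoinRoot.eval₂_root (frobTwistPoly A q)
  rw [eval₂_sub, eval₂_X_pow, eval₂_C, sub_eq_zero] at h
  rw [AdjoinRoot.algebraMap_eq]
  exact h.symm

/-- `y^q - x` vanishes at `y = X` over `x ↦ X^q`. [folklore] -/
theorem eval₂_expand_frobTwistPoly :
    eval₂ ((expand A q : A[X] →ₐ[A] A[X]) : A[X] →+* A[X]) X (frobTwistPoly A q) = 0 := by
  rw [eval₂_sub, eval₂_X_pow, eval₂_C, RingHom.coe_coe, expand_X, sub_self]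

/-- The ring map `A[x][y]/(y^q - x) → A[X]`, `y ↦ X`, `x ↦ X^q`. [folklore] -/
def toPolynomial : FrobTwist A q →ₐ[A] A[X] :=
  { AdjoinRoot.lift ((expand A q : A[X] →ₐ[A] A[X]) : A[X] →+* A[X]) X
      (eval₂_expand_frobTwistPoly A q) with
    commutes' := fun a => by
      change AdjoinRoot.lift ((expand A q : A[X] →ₐ[A] A[X]) : A[X] →+* A[X]) X
        (eval₂_expand_frobTwistPoly A q) (algebraMap A (FrobTwist A q) a) = algebraMap A A[X] a
      rw [IsScalarTower.algebraMap_apply A A[X] (FrobTwist A q), AdjoinRoot.algebraMap_eq,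
        AdjoinRoot.lift_of, RingHom.coe_coe, Polynomial.algebraMap_apply, Algebra.algebraMap_self,
        RingHom.id_apply, expand_C] }

/-- `toPolynomial` sends `y` to `X`. [folklore] -/
theorem toPolynomial_root : toPolynomial A q (AdjoinRoot.root (frobTwistPoly A q)) = X := by
  change AdjoinRoot.lift ((expand A q : A[X] →ₐ[A] A[X]) : A[X] →+* A[X]) X
    (eval₂_expand_frobTwistPoly A q) (AdjoinRoot.root _) = X
  exact AdjoinRoot.lift_root _

/-- `toPolynomial` is `expand` on `A[x]`. [folklore] -/
theorem toPolynomial_of (g : A[X]) :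
    toPolynomial A q (algebraMap A[X] (FrobTwist A q) g) = expand A q g := by
  change AdjoinRoot.lift ((expand A q : A[X] →ₐ[A] A[X]) : A[X] →+* A[X]) X
    (eval₂_expand_frobTwistPoly A q) (algebraMap A[X] (FrobTwist A q) g) = _
  rw [AdjoinRoot.algebraMap_eq, AdjoinRoot.lift_of, RingHom.coe_coe]

/-- The ring map `A[X] → A[x][y]/(y^q - x)`, `X ↦ y`. [folklore] -/
def ofPolynomial : A[X] →ₐ[A] FrobTwist A q :=
  Polynomial.aeval (AdjoinRoot.root (frobTwistPoly A q))

/-- `ofPolynomial` sends `X` to `y`. [folklore] -/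
theorem ofPolynomial_X : ofPolynomial A q X = AdjoinRoot.root (frobTwistPoly A q) :=
  Polynomial.aeval_X _

/-- `toPolynomial ∘ ofPolynomial = id`. [folklore] -/
theorem toPolynomial_comp_ofPolynomial :
    (toPolynomial A q).comp (ofPolynomial A q) = AlgHom.id A A[X] := by
  refine Polynomial.algHom_ext ?_
  rw [AlgHom.comp_apply, ofPolynomial_X, toPolynomial_root, AlgHom.id_apply]

/-- `ofPolynomial ∘ toPolynomial` fixes `A[x]` (as `x = y^q`). [folklore] -/
theorem ofPolynomial_toPolynomial_of (g : A[X]) :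
    ofPolynomial A q (toPolynomial A q (algebraMap A[X] (FrobTwist A q) g)) =
      algebraMap A[X] (FrobTwist A q) g := by
  rw [toPolynomial_of]
  change aeval (AdjoinRoot.root (frobTwistPoly A q)) (expand A q g) = _
  rw [expand_aeval, ← of_X]
  have h : aeval (algebraMap A[X] (FrobTwist A q) X) g =
      (IsScalarTower.toAlgHom A A[X] (FrobTwist A q)) (aeval X g) := by
    rw [← Polynomial.aeval_algHom_apply]
    rfl
  rw [h, Polynomial.aeval_X_left_apply]
  rfl

/-- `ofPolynomial ∘ toPolynomial = id`. [folklore] -/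
theorem ofPolynomial_comp_toPolynomial :
    (ofPolynomial A q).comp (toPolynomial A q) = AlgHom.id A (FrobTwist A q) := by
  -- `ofPolynomial ∘ toPolynomial` is `A[x]`-linear; compare on the root
  let ψ : FrobTwist A q →ₐ[A[X]] FrobTwist A q :=
    { ((ofPolynomial A q).comp (toPolynomial A q) : FrobTwist A q →+* FrobTwist A q) with
      commutes' := fun g => ofPolynomial_toPolynomial_of A q g }
  have hψ : ψ = AlgHom.id A[X] (FrobTwist A q) := by
    refine AdjoinRoot.algHom_ext ?_
    change ofPolynomial A q (toPolynomial A q (AdjoinRoot.root _)) = AdjoinRoot.root _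
    rw [toPolynomial_root, ofPolynomial_X]
  refine AlgHom.ext fun z => ?_
  have hz := congrArg (fun φ => φ z) hψ
  exact hz

/-- **`A[x][y]/(y^q - x) ≅ A[X]` as `A`-algebras** (`y ↦ X`, `x ↦ X^q`). [folklore] -/
theorem exists_algEquiv_polynomial :
    ∃ e : FrobTwist A q ≃ₐ[A] A[X], ∀ z, e z = toPolynomial A q z :=
  ⟨AlgEquiv.ofAlgHom (toPolynomial A q) (ofPolynomial A q) (toPolynomial_comp_ofPolynomial A q)
    (ofPolynomial_comp_toPolynomial A q), fun _ => rfl⟩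

/-- `A[x] → A[x][y]/(y^q - x)` is injective for `q ≠ 0` (it becomes `expand` in `A[X]`).
[folklore] -/
theorem algebraMap_injective (hq : q ≠ 0) :
    Function.Injective (algebraMap A[X] (FrobTwist A q)) := fun g g' h => by
  have h1 := congrArg (toPolynomial A q) h
  rw [toPolynomial_of, toPolynomial_of] at h1
  exact expand_injective (Nat.pos_of_ne_zero hq) h1

/-! ## `q`-th roots in `T' ⊗_A L` -/

section Roots

variable (L : Type u) [CommRing L] [Algebra A L]

/-- **`g ⊗ 1` is a `q`-th power in `T' ⊗_A L`**, namely `(Σ_j y^j ⊗ c_j^{1/q})^q`, when `q = p^e` is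
a power of the (exponential) characteristic `p` of `T' ⊗_A L` and `L` contains `q`-th roots
`rt(c_j)` of the coefficients `c_j` of `g` (Frobenius is additive, and `x = y^q`). [folklore] -/
theorem exists_pow_eq_algebraMap (p e : ℕ) [ExpChar (FrobTwist A q ⊗[A] L) p] (hq : q = p ^ e)
    (rt : A → L) (g : A[X])
    (hrt : ∀ j ∈ g.support, rt (g.coeff j) ^ q = algebraMap A L (g.coeff j)) :
    ∃ z : FrobTwist A q ⊗[A] L, z ^ q = algebraMap A[X] (FrobTwist A q ⊗[A] L) g := by
  subst hq
  refine ⟨∑ j ∈ g.support, (AdjoinRoot.root (frobTwistPoly A (p ^ e)) ^ j) ⊗ₜ[A] rt (g.coeff j), ?_⟩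
  have hfrob : ∀ z : FrobTwist A (p ^ e) ⊗[A] L,
      z ^ p ^ e = iterateFrobenius (FrobTwist A (p ^ e) ⊗[A] L) p e z := fun z => by
    rw [iterateFrobenius_def]
  rw [hfrob, map_sum]
  have hterm : ∀ j ∈ g.support,
      iterateFrobenius (FrobTwist A (p ^ e) ⊗[A] L) p e
          ((AdjoinRoot.root (frobTwistPoly A (p ^ e)) ^ j) ⊗ₜ[A] rt (g.coeff j)) =
        (g.coeff j • (AdjoinRoot.root (frobTwistPoly A (p ^ e)) ^ p ^ e) ^ j) ⊗ₜ[A] (1 : L) := by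
    intro j hj
    rw [← hfrob, Algebra.TensorProduct.tmul_pow, hrt j hj, ← pow_mul, mul_comm j (p ^ e), pow_mul,
      Algebra.algebraMap_eq_smul_one, tmul_smul, smul_tmul']
  rw [Finset.sum_congr rfl hterm, Algebra.TensorProduct.algebraMap_apply, ← sum_tmul]
  congr 1
  conv_rhs => rw [g.as_sum_support_C_mul_X_pow, map_sum]
  refine Finset.sum_congr rfl fun j _ => ?_
  rw [map_mul, map_pow, of_X, Algebra.smul_def,
    IsScalarTower.algebraMap_apply A A[X] (FrobTwist A (p ^ e)) (g.coeff j), Polynomial.algebraMap_apply,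
    Algebra.algebraMap_self, RingHom.id_apply]

end Roots

end FrobTwist

end Literature.AlgebraicGeometry.Resolution

end
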